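import Literature.NumberTheory.EllipticCurves.BhargavaHo2022.TwoMarkedPoints
import HarnessLib

/-!
# Cell bsd-rank2 (TWIN leaf `PAdicBSDRankTwoPositiveProportion`, door D-count): the bookkeeping of
# averages, proportions and densities along the height on Bhargava–Ho's family `F₂` (theorems only)

Cell-side file (cell bsd-rank2; seat bsd-rank2-lit GEN 9 for the p2 lane's counting door,
`HOME/p2/PADIC-R2-G8.md` §3 K3, director-bsd ruling 2026-08-26T01:56:50Z registering the TWIN-axis
leaf `PAdicBSDRankTwoPositiveProportion`). It is the PUBLIC API of the Literature vocabulary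
`Literature/NumberTheory/EllipticCurves/BhargavaHo2022/TwoMarkedPoints.lean` (`CongruenceFamily₂`,
`below`, `averageOn`, `proportionOn`, `AverageOnLE`, `DensityOnGE`, `HasPositiveLowerDensityOn`,
`HasDensityOn`; that file carries these lemmas only privately) which the leaf and the glue of its
D-0059 route need, all PROVED, no named fact, standard axioms:

* `proportionOn_eq_card_filter_div` — a proportion is `#{a ∈ Φ.below X | P a} / #(Φ.below X)`;
  `proportionOn_nonneg`, `proportionOn_le_one`, `proportionOn_mono`, `proportionOn_add_le`
  (inclusion–exclusion), `proportionOn_eq_one_of_forall`, `averageOn_mono`, `averageOn_eq_sum_div`;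
* monotonicity / weakening of the four limit notions: `averageOnLE_mono`, `averageOnLE_of_le`,
  `densityOnGE_mono`, `densityOnGE_of_le`, `densityOnGE_zero`, `hasPositiveLowerDensityOn_mono`,
  `densityOnGE_of_hasDensityOn`, `hasDensityOn_one_iff_densityOnGE_one`, `hasDensityOn_one_mono`;
* combination: `densityOnGE_and` (`δ₁ + δ₂ - 1`), `hasDensityOn_one_and` (two 100 % properties
  hold jointly for 100 %), `hasPositiveLowerDensityOn_and_of_hasDensityOn_one` (a 100 % property —
  e.g. Bhargava–Ho Thm. 10.1, the tree fact `BhargavaHo2022.thm10_1_F2` — meets a positive-proportion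
  property in a positive proportion), `hasPositiveLowerDensityOn_of_densityOnGE`;
* the **counting-to-density transfer** `densityOnGE_of_counting_inequality` /
  `hasPositiveLowerDensityOn_of_counting_inequality` = the density form of the door's kernel K3
  (`HOME/p2/PadicRank2SketchG8.lean`, `countingDoor_density`) over the tree vocabulary: if along the
  height balls `c₀·#B + c₁·#{a ∈ B | W a} ≤ c₂·#{a ∈ B | G a} + ∑_{a ∈ B} f a` (`B = Φ.below X`,
  `c₁ ≥ 0`, `c₂ > 0`), the average of `f` is at most `A` (limsup, `AverageOnLE`) and the proportion
  of `W` is at least `ρ` (liminf, `DensityOnGE`), then the proportion of `G` is at least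
  `(c₀ + c₁ρ - A)/c₂` (liminf), positive as soon as `A < c₀ + c₁ρ`. Door instance (p2-g8 §3.2–3.4):
  `f = #Sel_p`, `W = (w = +1)`, `G = (rank = 2 ∧ Ш[p^∞] = ⊥)`, `c₀ = p³`, `c₁ = p⁴ - p³`,
  `c₂ = p⁴ - p²`; at `p = 3` the threshold reads `A < 27 + 54ρ`.
* the member-wise form `three_level_counting_inequality` / `counting_inequality_of_memberwise_bounds`
  / `densityOnGE_of_memberwise_bounds` / `hasPositiveLowerDensityOn_of_memberwise_bounds`: the
  per-ball inequality itself from three member-wise lower bounds `f ≥ c_lo` (all members),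
  `f ≥ c_mid` (off `W`), `f ≥ c_hi` (on `W ∖ G`) — the generic half of the door's K3 — and the whole
  bookkeeping chain to a positive proportion of `G`;
* `eventually_card_below_pos_all` — the height balls of the whole family are nonempty from `X = 2`
  on (member `(0, 1, -1, 0)`: `y² = x³ - x`), discharging the transfer lemmas' nonemptiness
  hypothesis for `Φ = all`.

Everything here is elementary real analysis of finite averages; nothing of Bhargava–Ho is restated.
Junk-value convention of the vocabulary: when no member of `Φ` has height `< X`, `averageOn` and
`proportionOn` are `0`, so the transfer lemmas carry the hypothesis `∀ᶠ X, 0 < #(Φ.below X)`.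
PARTITION: none — r_an ≥ 2, summit axis S0; TWIN (D-0056): n/a. B1 honesty: bookkeeping only; no
declaration here mentions the analytic rank, a Selmer group or an `L`-function.
-/

open Filter Topology Finset

open Literature.NumberTheory.EllipticCurves.BhargavaHo2022

namespace Summit.BirchSwinnertonDyer.Rank2

variable (Φ : CongruenceFamily₂)

/-! ### Finite averages and proportions -/

/-- The average of `f` over the height ball, spelled out. [folklore] -/
theorem averageOn_eq_sum_div (f : Params → ℝ) (X : ℕ) :
    Φ.averageOn f X = (∑ a ∈ Φ.below X, f a) / (Φ.below X).card := rfl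

/-- A proportion is the average of an indicator. [folklore] -/
theorem proportionOn_eq_averageOn (P : Params → Prop) [DecidablePred P] (X : ℕ) :
    Φ.proportionOn P X = Φ.averageOn (fun a ↦ if P a then 1 else 0) X := by
  unfold CongruenceFamily₂.proportionOn
  congr 1
  funext a
  congr 1

/-- A proportion is `#{a ∈ Φ.below X | P a} / #(Φ.below X)`. [folklore] -/
theorem proportionOn_eq_card_filter_div (P : Params → Prop) [DecidablePred P] (X : ℕ) :
    Φ.proportionOn P X = (((Φ.below X).filter P).card : ℝ) / (Φ.below X).card := by
  rw [proportionOn_eq_averageOn Φ P X, averageOn_eq_sum_div, Finset.sum_boole]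

/-- A proportion is nonnegative. [folklore] -/
theorem proportionOn_nonneg (P : Params → Prop) (X : ℕ) : 0 ≤ Φ.proportionOn P X := by
  classical
  rw [proportionOn_eq_card_filter_div Φ P X]
  positivity

/-- A proportion is at most `1`. [folklore] -/
theorem proportionOn_le_one (P : Params → Prop) (X : ℕ) : Φ.proportionOn P X ≤ 1 := by
  classical
  rw [proportionOn_eq_card_filter_div Φ P X]
  rcases Nat.eq_zero_or_pos (Φ.below X).card with h0 | hpos
  · rw [h0, Nat.cast_zero, div_zero]; exact zero_le_one
  · rw [div_le_one (by exact_mod_cast hpos)]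
    exact_mod_cast Finset.card_filter_le _ _

/-- Proportions are monotone in the property. [folklore] -/
theorem proportionOn_mono {P Q : Params → Prop} (h : ∀ a, P a → Q a) (X : ℕ) :
    Φ.proportionOn P X ≤ Φ.proportionOn Q X := by
  classical
  rw [proportionOn_eq_card_filter_div Φ P X, proportionOn_eq_card_filter_div Φ Q X]
  gcongr with a _
  exact h a

/-- The proportion of an always-true property is `1` on a nonempty height ball. [folklore] -/
theorem proportionOn_eq_one_of_forall {P : Params → Prop} (h : ∀ a, Φ.Mem a → P a) {X : ℕ}
    (hX : 0 < (Φ.below X).card) : Φ.proportionOn P X = 1 := by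
  classical
  rw [proportionOn_eq_card_filter_div Φ P X]
  have hfilter : (Φ.below X).filter P = Φ.below X :=
    Finset.filter_true_of_mem fun a ha ↦ h a ((Φ.mem_below_iff a X).1 ha).1
  rw [hfilter, div_self]
  exact_mod_cast hX.ne'

/-- Inclusion–exclusion for indicators: `prop(P) + prop(Q) ≤ 1 + prop(P ∧ Q)` over any height ball.
[folklore] -/
theorem proportionOn_add_le (P Q : Params → Prop) (X : ℕ) :
    Φ.proportionOn P X + Φ.proportionOn Q X ≤ 1 + Φ.proportionOn (fun a ↦ P a ∧ Q a) X := by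
  classical
  simp only [proportionOn_eq_averageOn Φ, averageOn_eq_sum_div]
  rcases Nat.eq_zero_or_pos (Φ.below X).card with h0 | hpos
  · simp [h0]
  · have hc : (0 : ℝ) < (Φ.below X).card := by exact_mod_cast hpos
    rw [← add_div, ← Finset.sum_add_distrib, div_le_iff₀ hc, add_mul, one_mul,
      div_mul_cancel₀ _ hc.ne']
    have hcard : ((Φ.below X).card : ℝ) = ∑ _a ∈ Φ.below X, (1 : ℝ) := by simp
    rw [hcard, ← Finset.sum_add_distrib]
    refine Finset.sum_le_sum fun a _ ↦ ?_
    by_cases hP : P a <;> by_cases hQ : Q a <;> simp [hP, hQ]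

/-- Averages are monotone in the integrand (pointwise on members). [folklore] -/
theorem averageOn_mono {f g : Params → ℝ} (h : ∀ a, Φ.Mem a → f a ≤ g a) (X : ℕ) :
    Φ.averageOn f X ≤ Φ.averageOn g X := by
  rw [averageOn_eq_sum_div, averageOn_eq_sum_div]
  exact div_le_div_of_nonneg_right
    (Finset.sum_le_sum fun a ha ↦ h a ((Φ.mem_below_iff a X).1 ha).1) (Nat.cast_nonneg _)

/-! ### The whole family has members of every large height bound -/

/-- The parameters `(0, 1, -1, 0)`: the curve `y² = (x - 1)(x + 1)x = x³ - x` (`Δ = 64`), of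
height `1`. [folklore] -/
theorem isMember_zero_one_neg_one_zero : (⟨0, 1, -1, 0⟩ : Params).IsMember := by
  simp only [Params.IsMember, Params.curveInt, WeierstrassCurve.Δ, WeierstrassCurve.b₂,
    WeierstrassCurve.b₄, WeierstrassCurve.b₆, WeierstrassCurve.b₈]
  norm_num

/-- For the whole family `F₂` the height balls are nonempty from `X = 2` on. [folklore] -/
theorem eventually_card_below_pos_all : ∀ᶠ X : ℕ in atTop, 0 < (CongruenceFamily₂.all.below X).card := by
  refine Filter.eventually_atTop.2 ⟨2, fun X hX ↦ Finset.card_pos.2 ⟨⟨0, 1, -1, 0⟩, ?_⟩⟩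
  rw [CongruenceFamily₂.mem_below_iff, CongruenceFamily₂.mem_all_iff]
  refine ⟨isMember_zero_one_neg_one_zero, lt_of_lt_of_le ?_ (Nat.cast_le.2 hX)⟩
  simp only [Params.height]
  norm_num

/-! ### Monotonicity and weakening of the limit notions -/

/-- `limsup avg f ≤ c` is inherited by pointwise smaller integrands. [folklore] -/
theorem averageOnLE_mono {f g : Params → ℝ} {c : ℝ} (hf : Φ.AverageOnLE f c)
    (h : ∀ a, Φ.Mem a → g a ≤ f a) : Φ.AverageOnLE g c := fun ε hε ↦
  (hf ε hε).mono fun X hX ↦ (averageOn_mono Φ h X).trans hX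

/-- `limsup avg f ≤ c` implies `limsup avg f ≤ c'` for `c ≤ c'`. [folklore] -/
theorem averageOnLE_of_le {f : Params → ℝ} {c c' : ℝ} (hf : Φ.AverageOnLE f c) (h : c ≤ c') :
    Φ.AverageOnLE f c' := fun ε hε ↦
  (hf ε hε).mono fun X hX ↦ hX.trans (by linarith)

/-- A lower density is inherited by weaker properties. [folklore] -/
theorem densityOnGE_mono {P Q : Params → Prop} {δ : ℝ} (hP : Φ.DensityOnGE P δ)
    (h : ∀ a, P a → Q a) : Φ.DensityOnGE Q δ := fun ε hε ↦
  (hP ε hε).mono fun X hX ↦ hX.trans (proportionOn_mono Φ h X)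

/-- A lower density `≥ δ` implies a lower density `≥ δ'` for `δ' ≤ δ`. [folklore] -/
theorem densityOnGE_of_le {P : Params → Prop} {δ δ' : ℝ} (hP : Φ.DensityOnGE P δ) (h : δ' ≤ δ) :
    Φ.DensityOnGE P δ' := fun ε hε ↦
  (hP ε hε).mono fun X hX ↦ le_trans (by linarith) hX

/-- Every property has lower density `≥ 0`. [folklore] -/
theorem densityOnGE_zero (P : Params → Prop) : Φ.DensityOnGE P 0 := fun ε hε ↦
  Filter.Eventually.of_forall fun X ↦ by linarith [proportionOn_nonneg Φ P X]

/-- A positive lower density (with an explicit witness) is inherited by weaker properties. [folklore] -/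
theorem hasPositiveLowerDensityOn_mono {P Q : Params → Prop} (hP : Φ.HasPositiveLowerDensityOn P)
    (h : ∀ a, P a → Q a) : Φ.HasPositiveLowerDensityOn Q := by
  obtain ⟨δ, hδ, hev⟩ := hP
  exact ⟨δ, hδ, hev.mono fun X hX ↦ hX.trans (proportionOn_mono Φ h X)⟩

/-- A lower density `≥ δ > 0` in the ε-form gives a positive lower density with witness `δ/2`.
[folklore] -/
theorem hasPositiveLowerDensityOn_of_densityOnGE {P : Params → Prop} {δ : ℝ} (hP : Φ.DensityOnGE P δ)
    (hδ : 0 < δ) : Φ.HasPositiveLowerDensityOn P :=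
  ⟨δ / 2, by linarith, (hP (δ / 2) (by linarith)).mono fun X hX ↦ by linarith⟩

/-- A positive lower density gives a lower density `≥ δ` in the ε-form for its witness `δ`. [folklore] -/
theorem exists_densityOnGE_of_hasPositiveLowerDensityOn {P : Params → Prop}
    (hP : Φ.HasPositiveLowerDensityOn P) : ∃ δ : ℝ, 0 < δ ∧ Φ.DensityOnGE P δ := by
  obtain ⟨δ, hδ, hev⟩ := hP
  exact ⟨δ, hδ, fun ε hε ↦ hev.mono fun X hX ↦ by linarith⟩

/-- A density `δ` (limit of the proportions) is in particular a lower density `≥ δ`. [folklore] -/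
theorem densityOnGE_of_hasDensityOn {P : Params → Prop} {δ : ℝ} (hP : Φ.HasDensityOn P δ) :
    Φ.DensityOnGE P δ := fun ε hε ↦
  ((tendsto_order.1 hP).1 (δ - ε) (by linarith)).mono fun X hX ↦ hX.le

/-- "100 %" as a limit and as a lower density are the same thing (proportions never exceed `1`).
[folklore] -/
theorem hasDensityOn_one_iff_densityOnGE_one (P : Params → Prop) :
    Φ.HasDensityOn P 1 ↔ Φ.DensityOnGE P 1 := by
  refine ⟨fun h ↦ densityOnGE_of_hasDensityOn Φ h, fun h ↦ tendsto_order.2 ⟨fun b hb ↦ ?_, fun b hb ↦ ?_⟩⟩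
  · exact (h ((1 - b) / 2) (by linarith)).mono fun X hX ↦ by linarith
  · exact Filter.Eventually.of_forall fun X ↦ (proportionOn_le_one Φ P X).trans_lt hb

/-- A 100 % property implies every weaker property for 100 %. [folklore] -/
theorem hasDensityOn_one_mono {P Q : Params → Prop} (hP : Φ.HasDensityOn P 1)
    (h : ∀ a, P a → Q a) : Φ.HasDensityOn Q 1 :=
  (hasDensityOn_one_iff_densityOnGE_one Φ Q).2
    (densityOnGE_mono Φ ((hasDensityOn_one_iff_densityOnGE_one Φ P).1 hP) h)

/-! ### Combining two properties -/

/-- Lower densities add by inclusion–exclusion: `dens(P ∧ Q) ≥ dens P + dens Q - 1`. [folklore] -/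
theorem densityOnGE_and {P Q : Params → Prop} {δ₁ δ₂ : ℝ} (hP : Φ.DensityOnGE P δ₁)
    (hQ : Φ.DensityOnGE Q δ₂) : Φ.DensityOnGE (fun a ↦ P a ∧ Q a) (δ₁ + δ₂ - 1) := fun ε hε ↦
  ((hP (ε / 2) (by linarith)).and (hQ (ε / 2) (by linarith))).mono fun X hX ↦ by
    have := proportionOn_add_le Φ P Q X
    linarith [hX.1, hX.2]

/-- Two properties that each hold for 100 % of `Φ` hold jointly for 100 % of `Φ`. [folklore] -/
theorem hasDensityOn_one_and {P Q : Params → Prop} (hP : Φ.HasDensityOn P 1)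
    (hQ : Φ.HasDensityOn Q 1) : Φ.HasDensityOn (fun a ↦ P a ∧ Q a) 1 := by
  rw [hasDensityOn_one_iff_densityOnGE_one] at hP hQ ⊢
  have h := densityOnGE_and Φ hP hQ
  norm_num at h
  exact h

/-- A 100 % property meets a property of positive lower density in a set of positive lower density
(witness `δ/2`). [folklore] -/
theorem hasPositiveLowerDensityOn_and_of_hasDensityOn_one {P Q : Params → Prop}
    (hP : Φ.HasDensityOn P 1) (hQ : Φ.HasPositiveLowerDensityOn Q) :
    Φ.HasPositiveLowerDensityOn (fun a ↦ P a ∧ Q a) := by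
  obtain ⟨δ, hδ, hQδ⟩ := exists_densityOnGE_of_hasPositiveLowerDensityOn Φ hQ
  have h := densityOnGE_and Φ ((hasDensityOn_one_iff_densityOnGE_one Φ P).1 hP) hQδ
  have h' : Φ.DensityOnGE (fun a ↦ P a ∧ Q a) δ := densityOnGE_of_le Φ h (by linarith)
  exact hasPositiveLowerDensityOn_of_densityOnGE Φ h' hδ

/-- Symmetric form: a property of positive lower density meets a 100 % property in a set of
positive lower density. [folklore] -/
theorem hasPositiveLowerDensityOn_and_hasDensityOn_one {P Q : Params → Prop}
    (hP : Φ.HasPositiveLowerDensityOn P) (hQ : Φ.HasDensityOn Q 1) :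
    Φ.HasPositiveLowerDensityOn (fun a ↦ P a ∧ Q a) :=
  hasPositiveLowerDensityOn_mono Φ (hasPositiveLowerDensityOn_and_of_hasDensityOn_one Φ hQ hP)
    fun _ h ↦ ⟨h.2, h.1⟩

/-! ### From a per-ball counting inequality to a lower density -/

/-- **Counting-to-density transfer.** Let `f : Params → ℝ`, properties `W`, `G`, and reals
`c₀`, `c₁ ≥ 0`, `c₂ > 0`. Suppose that for all large `X`, on the height ball `B = Φ.below X`,
`c₀ · #B + c₁ · #{a ∈ B | W a} ≤ c₂ · #{a ∈ B | G a} + ∑_{a ∈ B} f a`,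
that `limsup_X avg_B f ≤ A` (`AverageOnLE`), that `liminf_X prop_B W ≥ ρ` (`DensityOnGE`), and that
the balls are eventually nonempty. Then `liminf_X prop_B G ≥ (c₀ + c₁ ρ - A) / c₂`.
(Proof: divide the inequality by `#B` and pass to the ε-forms.) [folklore] -/
theorem densityOnGE_of_counting_inequality {f : Params → ℝ} {W G : Params → Prop}
    [DecidablePred W] [DecidablePred G] {c₀ c₁ c₂ A ρ : ℝ} (hc₁ : 0 ≤ c₁) (hc₂ : 0 < c₂)
    (hcount : ∀ᶠ X : ℕ in atTop,
      c₀ * (Φ.below X).card + c₁ * ((Φ.below X).filter W).card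
        ≤ c₂ * ((Φ.below X).filter G).card + ∑ a ∈ Φ.below X, f a)
    (hA : Φ.AverageOnLE f A) (hρ : Φ.DensityOnGE W ρ)
    (hB : ∀ᶠ X : ℕ in atTop, 0 < (Φ.below X).card) :
    Φ.DensityOnGE G ((c₀ + c₁ * ρ - A) / c₂) := by
  intro ε hε
  -- choose `η > 0` with `(η + c₁ η)/c₂ ≤ ε`
  set η : ℝ := ε * c₂ / (1 + c₁) with hη
  have h1c₁ : 0 < 1 + c₁ := by linarith
  have hη0 : 0 < η := by rw [hη]; positivity
  have hηε : (η + c₁ * η) / c₂ = ε := by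
    rw [hη]; field_simp
  filter_upwards [hcount, hA η hη0, hρ η hη0, hB] with X hcX hAX hρX hBX
  have hcard : (0 : ℝ) < (Φ.below X).card := by exact_mod_cast hBX
  rw [proportionOn_eq_card_filter_div Φ G X]
  rw [proportionOn_eq_card_filter_div Φ W X] at hρX
  rw [averageOn_eq_sum_div] at hAX
  -- divide the counting inequality by `#B`
  have hdiv : c₀ + c₁ * ((((Φ.below X).filter W).card : ℝ) / (Φ.below X).card)
      ≤ c₂ * ((((Φ.below X).filter G).card : ℝ) / (Φ.below X).card)
        + (∑ a ∈ Φ.below X, f a) / (Φ.below X).card := by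
    rw [mul_div_assoc', mul_div_assoc', ← add_div, le_div_iff₀ hcard, add_mul,
      div_mul_cancel₀ _ hcard.ne']
    linarith
  -- combine with the ε-forms
  have hW : c₁ * (ρ - η) ≤ c₁ * ((((Φ.below X).filter W).card : ℝ) / (Φ.below X).card) :=
    mul_le_mul_of_nonneg_left hρX hc₁
  have hmain : c₀ + c₁ * ρ - A - (η + c₁ * η)
      ≤ c₂ * ((((Φ.below X).filter G).card : ℝ) / (Φ.below X).card) := by linarith
  rw [← hηε, ← sub_div, div_le_iff₀ hc₂]
  linarith

/-- **Counting-to-positive-proportion transfer**: under the hypotheses of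
`densityOnGE_of_counting_inequality`, if `A < c₀ + c₁ ρ` then `G` holds for a positive proportion
of `Φ` (positive lower density, witness `(c₀ + c₁ ρ - A) / (2 c₂)`). [folklore] -/
theorem hasPositiveLowerDensityOn_of_counting_inequality {f : Params → ℝ} {W G : Params → Prop}
    [DecidablePred W] [DecidablePred G] {c₀ c₁ c₂ A ρ : ℝ} (hc₁ : 0 ≤ c₁) (hc₂ : 0 < c₂)
    (hcount : ∀ᶠ X : ℕ in atTop,
      c₀ * (Φ.below X).card + c₁ * ((Φ.below X).filter W).card
        ≤ c₂ * ((Φ.below X).filter G).card + ∑ a ∈ Φ.below X, f a)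
    (hA : Φ.AverageOnLE f A) (hρ : Φ.DensityOnGE W ρ)
    (hB : ∀ᶠ X : ℕ in atTop, 0 < (Φ.below X).card) (hpos : A < c₀ + c₁ * ρ) :
    Φ.HasPositiveLowerDensityOn G :=
  hasPositiveLowerDensityOn_of_densityOnGE Φ
    (densityOnGE_of_counting_inequality Φ hc₁ hc₂ hcount hA hρ hB) (div_pos (by linarith) hc₂)

/-! ### From member-wise three-level lower bounds to the counting inequality (the generic half of K3)

The door's per-ball inequality `c_mid·#B + (c_hi - c_mid)·#{W} ≤ (c_hi - c_lo)·#{G} + ∑ f` follows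
from three MEMBER-WISE lower bounds on the invariant `f`: `f ≥ c_lo` on every member, `f ≥ c_mid`
off `W`, and `f ≥ c_hi` on `W ∖ G` (door instance, p2-g8 K1/K2: `f = #Sel_p`, `W = (w = +1)`,
`G = (rank = 2 ∧ Ш[p^∞] = ⊥)`, `c_lo = p²` (rank `≥ 2`, `E[p](ℚ) = 0`), `c_mid = p³` (`w = -1` and
`p`-parity), `c_hi = p⁴` (`w = +1`, `p`-parity and `#Sel_p ≠ p²`)). This section proves that step
for an arbitrary finite index set and packages the whole chain
«member-wise bounds + `limsup avg f ≤ A` + `liminf prop W ≥ ρ` + `A < c_mid + (c_hi - c_mid)ρ`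
⟹ positive proportion of `G`» as `hasPositiveLowerDensityOn_of_memberwise_bounds`. -/

/-- **Three-level counting inequality** on a finite set `B`: if `c_lo ≤ f` on `B`, `c_mid ≤ f` on
`B ∖ W` and `c_hi ≤ f` on `(B ∩ W) ∖ G`, with `c_lo ≤ c_hi`, then
`c_mid · #B + (c_hi - c_mid) · #(B ∩ W) ≤ (c_hi - c_lo) · #(B ∩ G) + ∑_{i ∈ B} f i`. -/
theorem three_level_counting_inequality {ι : Type*} (B : Finset ι) (f : ι → ℝ)
    (W G : ι → Prop) [DecidablePred W] [DecidablePred G] {c_lo c_mid c_hi : ℝ}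
    (hlo_hi : c_lo ≤ c_hi) (h_lo : ∀ i ∈ B, c_lo ≤ f i) (h_mid : ∀ i ∈ B, ¬ W i → c_mid ≤ f i)
    (h_hi : ∀ i ∈ B, W i → ¬ G i → c_hi ≤ f i) :
    c_mid * B.card + (c_hi - c_mid) * (B.filter W).card
      ≤ (c_hi - c_lo) * (B.filter G).card + ∑ i ∈ B, f i := by
  -- the three-level minorant `g ≤ f`
  set g : ι → ℝ := fun i ↦
    c_mid + (c_hi - c_mid) * (if W i then 1 else 0) - (c_hi - c_lo) * (if W i ∧ G i then 1 else 0)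
    with hg
  have hgf : ∀ i ∈ B, g i ≤ f i := by
    intro i hi
    by_cases hW : W i
    · by_cases hG : G i
      · have := h_lo i hi
        simp only [hg, hW, hG, and_self, if_true, mul_one]
        linarith
      · have := h_hi i hi hW hG
        simp only [hg, hW, hG, and_false, if_true, if_false, mul_one, mul_zero, sub_zero]
        linarith
    · have := h_mid i hi hW
      simp only [hg, hW, false_and, if_false, mul_zero, add_zero, sub_zero]
      exact this
  have hsum_g : ∑ i ∈ B, g i = c_mid * B.card + (c_hi - c_mid) * (B.filter W).card
      - (c_hi - c_lo) * (B.filter fun i ↦ W i ∧ G i).card := by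
    simp only [hg, Finset.sum_sub_distrib, Finset.sum_add_distrib, Finset.sum_const,
      ← Finset.mul_sum, Finset.sum_boole]
    ring
  have hWG : (((B.filter fun i ↦ W i ∧ G i).card : ℕ) : ℝ) ≤ (B.filter G).card := by
    have hsub : (B.filter fun i ↦ W i ∧ G i) ⊆ B.filter G := by
      intro i hi
      rw [Finset.mem_filter] at hi ⊢
      exact ⟨hi.1, hi.2.2⟩
    exact_mod_cast Finset.card_le_card hsub
  have hle : ∑ i ∈ B, g i ≤ ∑ i ∈ B, f i := Finset.sum_le_sum hgf
  have hc : 0 ≤ c_hi - c_lo := by linarith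
  nlinarith [mul_le_mul_of_nonneg_left hWG hc]

/-- The per-ball counting hypothesis of `densityOnGE_of_counting_inequality` from three MEMBER-WISE
lower bounds holding on all of `Φ` (with `c₀ = c_mid`, `c₁ = c_hi - c_mid`, `c₂ = c_hi - c_lo`). -/
theorem counting_inequality_of_memberwise_bounds {f : Params → ℝ} {W G : Params → Prop}
    [DecidablePred W] [DecidablePred G] {c_lo c_mid c_hi : ℝ} (hlo_hi : c_lo ≤ c_hi)
    (h_lo : ∀ a, Φ.Mem a → c_lo ≤ f a) (h_mid : ∀ a, Φ.Mem a → ¬ W a → c_mid ≤ f a)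
    (h_hi : ∀ a, Φ.Mem a → W a → ¬ G a → c_hi ≤ f a) (X : ℕ) :
    c_mid * (Φ.below X).card + (c_hi - c_mid) * ((Φ.below X).filter W).card
      ≤ (c_hi - c_lo) * ((Φ.below X).filter G).card + ∑ a ∈ Φ.below X, f a :=
  three_level_counting_inequality (Φ.below X) f W G hlo_hi
    (fun a ha ↦ h_lo a ((Φ.mem_below_iff a X).1 ha).1)
    (fun a ha ↦ h_mid a ((Φ.mem_below_iff a X).1 ha).1)
    (fun a ha ↦ h_hi a ((Φ.mem_below_iff a X).1 ha).1)

/-- **The counting door, end to end (bookkeeping half).** Member-wise three-level bounds on `f`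
(`c_lo` everywhere, `c_mid` off `W`, `c_hi` on `W ∖ G`; `c_lo < c_hi`, `c_mid ≤ c_hi`), a first-moment
bound `limsup avg f ≤ A`, a lower density `liminf prop W ≥ ρ`, eventually nonempty height balls and
the threshold `A < c_mid + (c_hi - c_mid) ρ` give a POSITIVE PROPORTION of `G` in `Φ` (lower density
`≥ (c_mid + (c_hi - c_mid)ρ - A)/(c_hi - c_lo)`, `densityOnGE_of_memberwise_bounds`). Door D-count:
`c_lo = p²`, `c_mid = p³`, `c_hi = p⁴`, threshold `A < p³ + (p⁴ - p³)ρ` (`27 + 54ρ` at `p = 3`). -/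
theorem densityOnGE_of_memberwise_bounds {f : Params → ℝ} {W G : Params → Prop}
    [DecidablePred W] [DecidablePred G] {c_lo c_mid c_hi A ρ : ℝ} (hlo_hi : c_lo < c_hi)
    (hmid_hi : c_mid ≤ c_hi) (h_lo : ∀ a, Φ.Mem a → c_lo ≤ f a)
    (h_mid : ∀ a, Φ.Mem a → ¬ W a → c_mid ≤ f a) (h_hi : ∀ a, Φ.Mem a → W a → ¬ G a → c_hi ≤ f a)
    (hA : Φ.AverageOnLE f A) (hρ : Φ.DensityOnGE W ρ) (hB : ∀ᶠ X : ℕ in atTop, 0 < (Φ.below X).card) :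
    Φ.DensityOnGE G ((c_mid + (c_hi - c_mid) * ρ - A) / (c_hi - c_lo)) :=
  densityOnGE_of_counting_inequality Φ (by linarith) (by linarith)
    (Filter.Eventually.of_forall fun X ↦
      counting_inequality_of_memberwise_bounds Φ hlo_hi.le h_lo h_mid h_hi X) hA hρ hB

/-- Positive-proportion form of `densityOnGE_of_memberwise_bounds`. -/
theorem hasPositiveLowerDensityOn_of_memberwise_bounds {f : Params → ℝ} {W G : Params → Prop}
    [DecidablePred W] [DecidablePred G] {c_lo c_mid c_hi A ρ : ℝ} (hlo_hi : c_lo < c_hi)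
    (hmid_hi : c_mid ≤ c_hi) (h_lo : ∀ a, Φ.Mem a → c_lo ≤ f a)
    (h_mid : ∀ a, Φ.Mem a → ¬ W a → c_mid ≤ f a) (h_hi : ∀ a, Φ.Mem a → W a → ¬ G a → c_hi ≤ f a)
    (hA : Φ.AverageOnLE f A) (hρ : Φ.DensityOnGE W ρ) (hB : ∀ᶠ X : ℕ in atTop, 0 < (Φ.below X).card)
    (hpos : A < c_mid + (c_hi - c_mid) * ρ) : Φ.HasPositiveLowerDensityOn G :=
  hasPositiveLowerDensityOn_of_densityOnGE Φ
    (densityOnGE_of_memberwise_bounds Φ hlo_hi hmid_hi h_lo h_mid h_hi hA hρ hB)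
    (div_pos (by linarith) (by linarith))

end Summit.BirchSwinnertonDyer.Rank2
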